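import Summits.KontsevichZagierPeriods.KontsevichZagierPeriods.Theses.HurwitzMicroSectors
import Literature.NumberTheory.Transcendental.KZLogCalculusProofs
import Literature.NumberTheory.Transcendental.KZProductIdeal

/-!
# Crux `HurwitzSectorComplement` (stmt-KontsevichZagierPeriods-14341, route HurwitzMicroSectors) —
# line `chebyshev-level-deformation`, LEAD SKELETON (continuation c1)

`HurwitzSectorComplement := SectorTwoSix → AperySectorThreeTwo → NormalFormPrinciple` is the summit
(Disproof.lean `crux_iff_summit`). This line closes NEW territory below it — the real-algebraic span of
the symmetric (Bernoulli-parity) Hurwitz tower, i.e. the GALOIS relations among the values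
`ζ(w,a/L) + (−1)^w ζ(w,1−a/L) ∈ π^w·ℚ(ζ_L)^+`, none of which is a distribution relation — by the
Chebyshev ladder in the half-angle coordinate `v = tan(u/2)`, where every representation is RATIONAL:

* kernels `T(v,s) = ((1−s) − v²(1+s))/((1−s)²+v²(1+s)²) = Σ cos(nu) s^{n−1}`,
  `U(v,s) = 2v/((1−s)²+v²(1+s)²) = Σ sin(nu) s^{n−1}`, weight `ω(v) = 2/(1+v²)` (`du = ω dv`);
* certificates `∂_v T = −ω ∂_s(sU)`, `∂_v U = ω ∂_s(sT)` (polynomial identities);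
* S1 `stub_ladderEngine` (T-step / U-step: two Newton–Leibniz moves with rational primitives + one
  coordinate swap), S2a `stub_arcSimplex` (chains over cyclotomic arcs and the half-line are rational
  multiples of `𝔭_n = [(0,1)^n, ∏ 2/(1+x_i²)]`), S2b `stub_bottomCell` (the `m = 1` bottom of the
  ladder: the `x`-fibre of `U` is an arctan arc after an affine substitution), S3 `stub_ladderDescent`
  (induction down the ladder: `[box^w, T(tan(πj/L), t)]`, `[box^w, U(…)]`, `[box^w, 1/(1−t)]`,
  `[box^w, 1/(1+t)]` are rational multiples of `𝔭_w`), S4 `stub_partialFractions` (real-cyclotomic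
  partial fractions of the symmetric pair integrands), S5 `stub_assembly` (F-linearity of
  `FormalRep ⧸ relations` via `KZ.scale`, the landed rational reduction `stub_symReduction`, constants
  across dimensions, Lindemann) ⇒ `parityTowerSector`;
* S6 `stub_spliceRemainder : ParityTowerSector-statement → NormalFormPrinciple` is the DECLARED
  summit-strength remainder (≡ summit); it is not claimed and never briefed.

`HurwitzSectorComplement_of` concludes the crux BY NAME from S1–S6. Sorries live only in `stub_*`.
-/

noncomputable section

open Set MeasureTheory
open scoped BigOperators
open Literature.NumberTheory.Transcendental

namespace Summit.KontsevichZagierPeriods.Theorems.HurwitzMicroSectorsHurwitzSectorComplement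

open Summit.KontsevichZagierPeriods.KontsevichZagierPeriods.Theses.HurwitzMicroSectors

/-! ## S1 — the ladder engine (lead) -/

/-- **S1, ladder engine.** Over a base `box^{m+2} × D` (`D ⊆ ℝ^k` bounded `ℚ`-semialgebraic, bounded
semialgebraic weight `W`, semialgebraic parameter `0 < lam ≤ Λ`): the T-step
`[W·T(lam,p)] ≡ [W/(1−p)] − [W·ω(y₀)·U(y₀,p′)]` and the U-step `[W·U(lam,p)] ≡ [W·ω(y₀)·T(y₀,p′)]`,
the new parameter `y₀ ∈ (0, lam)` becoming the FIRST coordinate of the parameter block and the last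
box coordinate being integrated out (`p′` = product of the remaining `m+1` box coordinates). Two
Newton–Leibniz moves (primitives `W·T`, resp. `W·U`, in the parameter; `∓W ω x U(y₀,p′x)`, resp.
`W ω x T(y₀, p′x)`, in the last box coordinate — the certificates `∂_vT = −ω∂_s(sU)`,
`∂_vU = ω∂_s(sT)`), one coordinate swap, integrand additivity; band integrability by the domination
`≤ C (1−p)^{−3/2} y₀^{−1/2}`. [cite: KontsevichZagier2001, §1.2 rules (1)–(3)] -/
theorem stub_ladderEngine :
    (∀ (m k : ℕ) (D : Set (Fin k → ℝ)) (W lam : (Fin k → ℝ) → ℝ) (M Λ : ℝ),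
      Literature.ModelTheory.ExponentialFields.IsSemialgebraic ℚ D → Bornology.IsBounded D →
      IsSemialgebraicFunOn ℚ D W → IsSemialgebraicFunOn ℚ D lam →
      (∀ y ∈ D, |W y| ≤ M) → (∀ y ∈ D, 0 < lam y ∧ lam y ≤ Λ) →
      ∀ (r : KZ.IntegralRep (m + 2 + k)),
        r.domain = {z | (∀ i : Fin (m + 2), z (Fin.castAdd k i) ∈ Set.Ioo (0:ℝ) 1) ∧
          (fun j : Fin k => z (Fin.natAdd (m + 2) j)) ∈ D} →
        Set.EqOn r.integrand (fun z => W (fun j : Fin k => z (Fin.natAdd (m + 2) j)) *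
          (((1 - ∏ i : Fin (m + 2), z (Fin.castAdd k i)) -
              (lam (fun j : Fin k => z (Fin.natAdd (m + 2) j))) ^ 2 *
                (1 + ∏ i : Fin (m + 2), z (Fin.castAdd k i))) /
            ((1 - ∏ i : Fin (m + 2), z (Fin.castAdd k i)) ^ 2 +
              (lam (fun j : Fin k => z (Fin.natAdd (m + 2) j))) ^ 2 *
                (1 + ∏ i : Fin (m + 2), z (Fin.castAdd k i)) ^ 2))) r.domain →
        ∃ (r₁ : KZ.IntegralRep (m + 2 + k)) (r₂ : KZ.IntegralRep (m + 1 + (k + 1))),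
          r₁.domain = r.domain ∧
          (r₁.integrand = fun z => W (fun j : Fin k => z (Fin.natAdd (m + 2) j)) /
            (1 - ∏ i : Fin (m + 2), z (Fin.castAdd k i))) ∧
          r₂.domain = {z | (∀ i : Fin (m + 1), z (Fin.castAdd (k + 1) i) ∈ Set.Ioo (0:ℝ) 1) ∧
            (fun j : Fin k => z (Fin.natAdd (m + 1) j.succ)) ∈ D ∧
            0 < z (Fin.natAdd (m + 1) 0) ∧
            z (Fin.natAdd (m + 1) 0) < lam ((fun j : Fin k => z (Fin.natAdd (m + 1) j.succ)))} ∧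
          (r₂.integrand = fun z => W ((fun j : Fin k => z (Fin.natAdd (m + 1) j.succ))) *
            (2 / (1 + (z (Fin.natAdd (m + 1) 0)) ^ 2)) *
            (2 * z (Fin.natAdd (m + 1) 0) /
              ((1 - ∏ i : Fin (m + 1), z (Fin.castAdd (k + 1) i)) ^ 2 +
                (z (Fin.natAdd (m + 1) 0)) ^ 2 * (1 + ∏ i : Fin (m + 1), z (Fin.castAdd (k + 1) i)) ^ 2))) ∧
          KZ.of r - KZ.of r₁ + KZ.of r₂ ∈ KZ.relations) ∧
    (∀ (m k : ℕ) (D : Set (Fin k → ℝ)) (W lam : (Fin k → ℝ) → ℝ) (M Λ : ℝ),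
      Literature.ModelTheory.ExponentialFields.IsSemialgebraic ℚ D → Bornology.IsBounded D →
      IsSemialgebraicFunOn ℚ D W → IsSemialgebraicFunOn ℚ D lam →
      (∀ y ∈ D, |W y| ≤ M) → (∀ y ∈ D, 0 < lam y ∧ lam y ≤ Λ) →
      ∀ (r : KZ.IntegralRep (m + 2 + k)),
        r.domain = {z | (∀ i : Fin (m + 2), z (Fin.castAdd k i) ∈ Set.Ioo (0:ℝ) 1) ∧
          (fun j : Fin k => z (Fin.natAdd (m + 2) j)) ∈ D} →
        Set.EqOn r.integrand (fun z => W (fun j : Fin k => z (Fin.natAdd (m + 2) j)) *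
          (2 * lam (fun j : Fin k => z (Fin.natAdd (m + 2) j)) /
            ((1 - ∏ i : Fin (m + 2), z (Fin.castAdd k i)) ^ 2 +
              (lam (fun j : Fin k => z (Fin.natAdd (m + 2) j))) ^ 2 *
                (1 + ∏ i : Fin (m + 2), z (Fin.castAdd k i)) ^ 2))) r.domain →
        ∃ (r₂ : KZ.IntegralRep (m + 1 + (k + 1))),
          r₂.domain = {z | (∀ i : Fin (m + 1), z (Fin.castAdd (k + 1) i) ∈ Set.Ioo (0:ℝ) 1) ∧
            (fun j : Fin k => z (Fin.natAdd (m + 1) j.succ)) ∈ D ∧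
            0 < z (Fin.natAdd (m + 1) 0) ∧
            z (Fin.natAdd (m + 1) 0) < lam ((fun j : Fin k => z (Fin.natAdd (m + 1) j.succ)))} ∧
          (r₂.integrand = fun z => W ((fun j : Fin k => z (Fin.natAdd (m + 1) j.succ))) *
            (2 / (1 + (z (Fin.natAdd (m + 1) 0)) ^ 2)) *
            (((1 - ∏ i : Fin (m + 1), z (Fin.castAdd (k + 1) i)) -
                (z (Fin.natAdd (m + 1) 0)) ^ 2 * (1 + ∏ i : Fin (m + 1), z (Fin.castAdd (k + 1) i))) /
              ((1 - ∏ i : Fin (m + 1), z (Fin.castAdd (k + 1) i)) ^ 2 +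
                (z (Fin.natAdd (m + 1) 0)) ^ 2 * (1 + ∏ i : Fin (m + 1), z (Fin.castAdd (k + 1) i)) ^ 2))) ∧
          KZ.of r - KZ.of r₂ ∈ KZ.relations) := by
  sorry

/-! ## S2a — arcs and chains over arcs -/

/-- **S2a, chains over cyclotomic arcs.** (i) For `0 ≤ j₀ < j₁`, `2 j₁ < L`, the ordered chain
`{tan(πj₀/L) < y_{a−1} < ⋯ < y_0 < tan(πj₁/L)}` with weight `∏ 2/(1+y_i²)` (in angle coordinates the
simplex over the arc `(2πj₀/L, 2πj₁/L)`, volume `θ^a/a!` with `θ ∈ πℚ`) is KZ-equivalent to a RATIONAL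
multiple of `𝔭_a = [(0,1)^a, ∏ 2/(1+x_i²)]` (insertion dissection `a·Δ_a ≅ Δ_{a−1} × arc`, Möbius
rotations `v ↦ (v+τ)/(1−τv)` of finite order with algebraic `τ`, torsion-freeness of
`FormalRep ⧸ relations`); (ii) the half-line `[(0,∞), 1/(1+z²)]` is KZ-equivalent to
`𝔭_1 = [(0,1), 2/(1+x²)]` (`z = 2x/(1−x²)`). [cite: KontsevichZagier2001, §1.2] -/
theorem stub_arcSimplex :
    (∀ (a j₀ j₁ L : ℕ), j₀ < j₁ → 2 * j₁ < L → ∀ (r : KZ.IntegralRep a),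
      r.domain = {y | (∀ i, Real.tan (Real.pi * j₀ / L) < y i ∧ y i < Real.tan (Real.pi * j₁ / L)) ∧
        (∀ i i' : Fin a, i < i' → y i < y i')} →
      Set.EqOn r.integrand (fun y => ∏ i, 2 / (1 + (y i) ^ 2)) r.domain →
      ∃ q : ℚ, ∀ (s : KZ.IntegralRep a), s.domain = {x | ∀ i, x i ∈ Set.Ioo (0:ℝ) 1} →
        Set.EqOn s.integrand (fun x => (q : ℝ) * ∏ i, 2 / (1 + (x i) ^ 2)) s.domain →
        KZ.Equivalent r s) ∧
    (∀ (r : KZ.IntegralRep 1), r.domain = {z | 0 < z 0} →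
      Set.EqOn r.integrand (fun z => 1 / (1 + (z 0) ^ 2)) r.domain →
      ∀ (s : KZ.IntegralRep 1), s.domain = {x | ∀ i, x i ∈ Set.Ioo (0:ℝ) 1} →
        Set.EqOn s.integrand (fun x => ∏ i, 2 / (1 + (x i) ^ 2)) s.domain →
        KZ.Equivalent r s) := by
  sorry

/-! ## S2b — the bottom cell of the ladder (`m = 1`) -/

/-- **S2b, bottom cell.** Given S2a: for `0 < j`, `2j < L`, `v₀ = tan(πj/L)`, the representation
`[(0,1)_x × {0 < y_0 < ⋯ < y_k < v₀}, (∏ 2/(1+y_i²)) · U(y_0, x)]` is KZ-equivalent to a rational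
multiple of `𝔭_{k+2}`: the `x`-fibre substitution `z = (x(1+y₀²) − (1−y₀²))/(2y₀)` is affine with
`U dx = dz/(1+z²)`, `z ∈ ((y₀²−1)/(2y₀), y₀)`; the region splits (cells `y_i ≶ 1`, `z ≶ 0`) into
products of chains over the arcs `(0, π/2)`, `(π/2, 2πj/L)` and half-lines, via the Möbius maps
`z ↦ −1/z`, `z ↦ 2z/(1−z²)`, `z ↦ (z²−1)/(2z)`, `v ↦ (v−1)/(v+1)`. [cite: KontsevichZagier2001, §1.2] -/
theorem stub_bottomCell :
    (∀ (a j₀ j₁ L : ℕ), j₀ < j₁ → 2 * j₁ < L → ∀ (r : KZ.IntegralRep a),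
      r.domain = {y | (∀ i, Real.tan (Real.pi * j₀ / L) < y i ∧ y i < Real.tan (Real.pi * j₁ / L)) ∧
        (∀ i i' : Fin a, i < i' → y i < y i')} →
      Set.EqOn r.integrand (fun y => ∏ i, 2 / (1 + (y i) ^ 2)) r.domain →
      ∃ q : ℚ, ∀ (s : KZ.IntegralRep a), s.domain = {x | ∀ i, x i ∈ Set.Ioo (0:ℝ) 1} →
        Set.EqOn s.integrand (fun x => (q : ℝ) * ∏ i, 2 / (1 + (x i) ^ 2)) s.domain →
        KZ.Equivalent r s) →
    (∀ (r : KZ.IntegralRep 1), r.domain = {z | 0 < z 0} →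
      Set.EqOn r.integrand (fun z => 1 / (1 + (z 0) ^ 2)) r.domain →
      ∀ (s : KZ.IntegralRep 1), s.domain = {x | ∀ i, x i ∈ Set.Ioo (0:ℝ) 1} →
        Set.EqOn s.integrand (fun x => ∏ i, 2 / (1 + (x i) ^ 2)) s.domain →
        KZ.Equivalent r s) →
    ∀ (k j L : ℕ), 0 < j → 2 * j < L → ∀ (r : KZ.IntegralRep (1 + (k + 1))),
      r.domain = {z | z (Fin.castAdd (k + 1) 0) ∈ Set.Ioo (0:ℝ) 1 ∧
        (∀ i : Fin (k + 1), 0 < z (Fin.natAdd 1 i) ∧ z (Fin.natAdd 1 i) < Real.tan (Real.pi * j / L)) ∧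
        (∀ i i' : Fin (k + 1), i < i' → z (Fin.natAdd 1 i) < z (Fin.natAdd 1 i'))} →
      Set.EqOn r.integrand (fun z => (∏ i : Fin (k + 1), 2 / (1 + (z (Fin.natAdd 1 i)) ^ 2)) *
        (2 * z (Fin.natAdd 1 0) /
          ((1 - z (Fin.castAdd (k + 1) 0)) ^ 2 +
            (z (Fin.natAdd 1 0)) ^ 2 * (1 + z (Fin.castAdd (k + 1) 0)) ^ 2))) r.domain →
      ∃ q : ℚ, ∀ (s : KZ.IntegralRep (1 + (k + 1))), s.domain = {x | ∀ i, x i ∈ Set.Ioo (0:ℝ) 1} →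
        Set.EqOn s.integrand (fun x => (q : ℝ) * ∏ i, 2 / (1 + (x i) ^ 2)) s.domain →
        KZ.Equivalent r s := by
  sorry

/-! ## S3 — descent down the ladder -/

/-- **S3, ladder descent.** From S1, S2a, S2b: for cyclotomic half-angles `v₀ = tan(πj/L)`
(`0 < j`, `2j < L`) the Chebyshev box representations `[(0,1)^w, T(v₀, x₁⋯x_w)]` (`w ≥ 2` even) and
`[(0,1)^w, U(v₀, x₁⋯x_w)]` (`w ≥ 3` odd), and the level-1/2 representations `[(0,1)^w, 1/(1−t)]`,
`[(0,1)^w, 1/(1+t)]` (`w ≥ 2` even), are KZ-equivalent to RATIONAL multiples of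
`𝔭_w = [(0,1)^w, ∏ 2/(1+x_i²)]` (value `(π/2)^w`). Induction on `w`: each T-step peels a Fubini
product `[box^{m}, 1/(1−p)] × [chain, ω^{⊗}]`, each U-step lowers `m`, the bottom `m = 1` is S2b;
`ζ(even)` from the ladder at `v₀ = 1`: `[1/(1−t)] + [t/(1+t²)] ≡ 𝔘_{w−1,1}(1)` and the level-4
dilation algebra `(1+X+X²+X³) + (X−X³) ≡ (1 + 2^{−w} − 2^{1−2w})(1+X+X²+X³)`;
`[1/(1+t)] ≡ (1 − 2^{1−w})[1/(1−t)]`. [cite: KontsevichZagier2001, §1.2] -/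
theorem stub_ladderDescent :
    -- S1 (engine), verbatim
    ((∀ (m k : ℕ) (D : Set (Fin k → ℝ)) (W lam : (Fin k → ℝ) → ℝ) (M Λ : ℝ),
      Literature.ModelTheory.ExponentialFields.IsSemialgebraic ℚ D → Bornology.IsBounded D →
      IsSemialgebraicFunOn ℚ D W → IsSemialgebraicFunOn ℚ D lam →
      (∀ y ∈ D, |W y| ≤ M) → (∀ y ∈ D, 0 < lam y ∧ lam y ≤ Λ) →
      ∀ (r : KZ.IntegralRep (m + 2 + k)),
        r.domain = {z | (∀ i : Fin (m + 2), z (Fin.castAdd k i) ∈ Set.Ioo (0:ℝ) 1) ∧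
          (fun j : Fin k => z (Fin.natAdd (m + 2) j)) ∈ D} →
        Set.EqOn r.integrand (fun z => W (fun j : Fin k => z (Fin.natAdd (m + 2) j)) *
          (((1 - ∏ i : Fin (m + 2), z (Fin.castAdd k i)) -
              (lam (fun j : Fin k => z (Fin.natAdd (m + 2) j))) ^ 2 *
                (1 + ∏ i : Fin (m + 2), z (Fin.castAdd k i))) /
            ((1 - ∏ i : Fin (m + 2), z (Fin.castAdd k i)) ^ 2 +
              (lam (fun j : Fin k => z (Fin.natAdd (m + 2) j))) ^ 2 *
                (1 + ∏ i : Fin (m + 2), z (Fin.castAdd k i)) ^ 2))) r.domain →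
        ∃ (r₁ : KZ.IntegralRep (m + 2 + k)) (r₂ : KZ.IntegralRep (m + 1 + (k + 1))),
          r₁.domain = r.domain ∧
          (r₁.integrand = fun z => W (fun j : Fin k => z (Fin.natAdd (m + 2) j)) /
            (1 - ∏ i : Fin (m + 2), z (Fin.castAdd k i))) ∧
          r₂.domain = {z | (∀ i : Fin (m + 1), z (Fin.castAdd (k + 1) i) ∈ Set.Ioo (0:ℝ) 1) ∧
            (fun j : Fin k => z (Fin.natAdd (m + 1) j.succ)) ∈ D ∧
            0 < z (Fin.natAdd (m + 1) 0) ∧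
            z (Fin.natAdd (m + 1) 0) < lam ((fun j : Fin k => z (Fin.natAdd (m + 1) j.succ)))} ∧
          (r₂.integrand = fun z => W ((fun j : Fin k => z (Fin.natAdd (m + 1) j.succ))) *
            (2 / (1 + (z (Fin.natAdd (m + 1) 0)) ^ 2)) *
            (2 * z (Fin.natAdd (m + 1) 0) /
              ((1 - ∏ i : Fin (m + 1), z (Fin.castAdd (k + 1) i)) ^ 2 +
                (z (Fin.natAdd (m + 1) 0)) ^ 2 * (1 + ∏ i : Fin (m + 1), z (Fin.castAdd (k + 1) i)) ^ 2))) ∧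
          KZ.of r - KZ.of r₁ + KZ.of r₂ ∈ KZ.relations) ∧
    (∀ (m k : ℕ) (D : Set (Fin k → ℝ)) (W lam : (Fin k → ℝ) → ℝ) (M Λ : ℝ),
      Literature.ModelTheory.ExponentialFields.IsSemialgebraic ℚ D → Bornology.IsBounded D →
      IsSemialgebraicFunOn ℚ D W → IsSemialgebraicFunOn ℚ D lam →
      (∀ y ∈ D, |W y| ≤ M) → (∀ y ∈ D, 0 < lam y ∧ lam y ≤ Λ) →
      ∀ (r : KZ.IntegralRep (m + 2 + k)),
        r.domain = {z | (∀ i : Fin (m + 2), z (Fin.castAdd k i) ∈ Set.Ioo (0:ℝ) 1) ∧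
          (fun j : Fin k => z (Fin.natAdd (m + 2) j)) ∈ D} →
        Set.EqOn r.integrand (fun z => W (fun j : Fin k => z (Fin.natAdd (m + 2) j)) *
          (2 * lam (fun j : Fin k => z (Fin.natAdd (m + 2) j)) /
            ((1 - ∏ i : Fin (m + 2), z (Fin.castAdd k i)) ^ 2 +
              (lam (fun j : Fin k => z (Fin.natAdd (m + 2) j))) ^ 2 *
                (1 + ∏ i : Fin (m + 2), z (Fin.castAdd k i)) ^ 2))) r.domain →
        ∃ (r₂ : KZ.IntegralRep (m + 1 + (k + 1))),
          r₂.domain = {z | (∀ i : Fin (m + 1), z (Fin.castAdd (k + 1) i) ∈ Set.Ioo (0:ℝ) 1) ∧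
            (fun j : Fin k => z (Fin.natAdd (m + 1) j.succ)) ∈ D ∧
            0 < z (Fin.natAdd (m + 1) 0) ∧
            z (Fin.natAdd (m + 1) 0) < lam ((fun j : Fin k => z (Fin.natAdd (m + 1) j.succ)))} ∧
          (r₂.integrand = fun z => W ((fun j : Fin k => z (Fin.natAdd (m + 1) j.succ))) *
            (2 / (1 + (z (Fin.natAdd (m + 1) 0)) ^ 2)) *
            (((1 - ∏ i : Fin (m + 1), z (Fin.castAdd (k + 1) i)) -
                (z (Fin.natAdd (m + 1) 0)) ^ 2 * (1 + ∏ i : Fin (m + 1), z (Fin.castAdd (k + 1) i))) /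
              ((1 - ∏ i : Fin (m + 1), z (Fin.castAdd (k + 1) i)) ^ 2 +
                (z (Fin.natAdd (m + 1) 0)) ^ 2 * (1 + ∏ i : Fin (m + 1), z (Fin.castAdd (k + 1) i)) ^ 2))) ∧
          KZ.of r - KZ.of r₂ ∈ KZ.relations)) →
    -- S2a (arcs and chains), verbatim
    ((∀ (a j₀ j₁ L : ℕ), j₀ < j₁ → 2 * j₁ < L → ∀ (r : KZ.IntegralRep a),
      r.domain = {y | (∀ i, Real.tan (Real.pi * j₀ / L) < y i ∧ y i < Real.tan (Real.pi * j₁ / L)) ∧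
        (∀ i i' : Fin a, i < i' → y i < y i')} →
      Set.EqOn r.integrand (fun y => ∏ i, 2 / (1 + (y i) ^ 2)) r.domain →
      ∃ q : ℚ, ∀ (s : KZ.IntegralRep a), s.domain = {x | ∀ i, x i ∈ Set.Ioo (0:ℝ) 1} →
        Set.EqOn s.integrand (fun x => (q : ℝ) * ∏ i, 2 / (1 + (x i) ^ 2)) s.domain →
        KZ.Equivalent r s) ∧
    (∀ (r : KZ.IntegralRep 1), r.domain = {z | 0 < z 0} →
      Set.EqOn r.integrand (fun z => 1 / (1 + (z 0) ^ 2)) r.domain →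
      ∀ (s : KZ.IntegralRep 1), s.domain = {x | ∀ i, x i ∈ Set.Ioo (0:ℝ) 1} →
        Set.EqOn s.integrand (fun x => ∏ i, 2 / (1 + (x i) ^ 2)) s.domain →
        KZ.Equivalent r s)) →
    -- S2b (bottom cell), conclusion verbatim
    (∀ (k j L : ℕ), 0 < j → 2 * j < L → ∀ (r : KZ.IntegralRep (1 + (k + 1))),
      r.domain = {z | z (Fin.castAdd (k + 1) 0) ∈ Set.Ioo (0:ℝ) 1 ∧
        (∀ i : Fin (k + 1), 0 < z (Fin.natAdd 1 i) ∧ z (Fin.natAdd 1 i) < Real.tan (Real.pi * j / L)) ∧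
        (∀ i i' : Fin (k + 1), i < i' → z (Fin.natAdd 1 i) < z (Fin.natAdd 1 i'))} →
      Set.EqOn r.integrand (fun z => (∏ i : Fin (k + 1), 2 / (1 + (z (Fin.natAdd 1 i)) ^ 2)) *
        (2 * z (Fin.natAdd 1 0) /
          ((1 - z (Fin.castAdd (k + 1) 0)) ^ 2 +
            (z (Fin.natAdd 1 0)) ^ 2 * (1 + z (Fin.castAdd (k + 1) 0)) ^ 2))) r.domain →
      ∃ q : ℚ, ∀ (s : KZ.IntegralRep (1 + (k + 1))), s.domain = {x | ∀ i, x i ∈ Set.Ioo (0:ℝ) 1} →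
        Set.EqOn s.integrand (fun x => (q : ℝ) * ∏ i, 2 / (1 + (x i) ^ 2)) s.domain →
        KZ.Equivalent r s) →
    -- conclusion: the four descents
    (∀ (w j L : ℕ), 2 ≤ w → Even w → 0 < j → 2 * j < L → ∀ (r : KZ.IntegralRep w),
      r.domain = {x | ∀ i, x i ∈ Set.Ioo (0:ℝ) 1} →
      Set.EqOn r.integrand (fun x =>
        ((1 - ∏ i, x i) - (Real.tan (Real.pi * j / L)) ^ 2 * (1 + ∏ i, x i)) /
          ((1 - ∏ i, x i) ^ 2 + (Real.tan (Real.pi * j / L)) ^ 2 * (1 + ∏ i, x i) ^ 2)) r.domain →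
      ∃ q : ℚ, ∀ (s : KZ.IntegralRep w), s.domain = {x | ∀ i, x i ∈ Set.Ioo (0:ℝ) 1} →
        Set.EqOn s.integrand (fun x => (q : ℝ) * ∏ i, 2 / (1 + (x i) ^ 2)) s.domain →
        KZ.Equivalent r s) ∧
    (∀ (w j L : ℕ), 3 ≤ w → Odd w → 0 < j → 2 * j < L → ∀ (r : KZ.IntegralRep w),
      r.domain = {x | ∀ i, x i ∈ Set.Ioo (0:ℝ) 1} →
      Set.EqOn r.integrand (fun x =>
        2 * Real.tan (Real.pi * j / L) /
          ((1 - ∏ i, x i) ^ 2 + (Real.tan (Real.pi * j / L)) ^ 2 * (1 + ∏ i, x i) ^ 2)) r.domain →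
      ∃ q : ℚ, ∀ (s : KZ.IntegralRep w), s.domain = {x | ∀ i, x i ∈ Set.Ioo (0:ℝ) 1} →
        Set.EqOn s.integrand (fun x => (q : ℝ) * ∏ i, 2 / (1 + (x i) ^ 2)) s.domain →
        KZ.Equivalent r s) ∧
    (∀ (w : ℕ), 2 ≤ w → Even w → ∀ (r : KZ.IntegralRep w),
      r.domain = {x | ∀ i, x i ∈ Set.Ioo (0:ℝ) 1} →
      Set.EqOn r.integrand (fun x => 1 / (1 - ∏ i, x i)) r.domain →
      ∃ q : ℚ, ∀ (s : KZ.IntegralRep w), s.domain = {x | ∀ i, x i ∈ Set.Ioo (0:ℝ) 1} →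
        Set.EqOn s.integrand (fun x => (q : ℝ) * ∏ i, 2 / (1 + (x i) ^ 2)) s.domain →
        KZ.Equivalent r s) ∧
    (∀ (w : ℕ), 2 ≤ w → Even w → ∀ (r : KZ.IntegralRep w),
      r.domain = {x | ∀ i, x i ∈ Set.Ioo (0:ℝ) 1} →
      Set.EqOn r.integrand (fun x => 1 / (1 + ∏ i, x i)) r.domain →
      ∃ q : ℚ, ∀ (s : KZ.IntegralRep w), s.domain = {x | ∀ i, x i ∈ Set.Ioo (0:ℝ) 1} →
        Set.EqOn s.integrand (fun x => (q : ℝ) * ∏ i, 2 / (1 + (x i) ^ 2)) s.domain →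
        KZ.Equivalent r s) := by
  sorry

/-! ## S4 — partial fractions over the real cyclotomic field -/

/-- **S4, partial fractions.** For `0 < a < L` and `0 ≤ t < 1`: the symmetric pair integrand
`(t^{a−1} + t^{L−1−a})/(1−t^L) = (2/L) Σ_{j<L} cos(2πja/L)·(cos(2πj/L) − t)/(1 − 2cos(2πj/L)t + t²)`,
the antisymmetric one `(t^{a−1} − t^{L−1−a})/(1−t^L) = (2/L) Σ_{j<L} sin(2πja/L) sin(2πj/L)/(1 − 2cos(2πj/L)t + t²)`
(generating functions `Σ cos(nu)t^{n−1}`, `Σ sin(nu)t^{n−1}` and orthogonality of characters of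
`ℤ/L`), and the half-angle forms of the two Chebyshev kernels (`v = tan(u/2)`,
`cos u = (1−v²)/(1+v²)`, `sin u = 2v/(1+v²)`). [folklore] -/
theorem stub_partialFractions :
    (∀ (L a : ℕ), 0 < a → a < L → ∀ (t : ℝ), 0 ≤ t → t < 1 →
      (t ^ (a - 1) + t ^ (L - 1 - a)) / (1 - t ^ L) =
        2 / (L : ℝ) * ∑ j ∈ Finset.range L, Real.cos (2 * Real.pi * j * a / L) *
          ((Real.cos (2 * Real.pi * j / L) - t) / (1 - 2 * Real.cos (2 * Real.pi * j / L) * t + t ^ 2))) ∧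
    (∀ (L a : ℕ), 0 < a → a < L → ∀ (t : ℝ), 0 ≤ t → t < 1 →
      (t ^ (a - 1) - t ^ (L - 1 - a)) / (1 - t ^ L) =
        2 / (L : ℝ) * ∑ j ∈ Finset.range L, Real.sin (2 * Real.pi * j * a / L) *
          (Real.sin (2 * Real.pi * j / L) / (1 - 2 * Real.cos (2 * Real.pi * j / L) * t + t ^ 2))) ∧
    (∀ (u t : ℝ), 0 < u → u < Real.pi →
      (Real.cos u - t) / (1 - 2 * Real.cos u * t + t ^ 2) =
        ((1 - t) - (Real.tan (u / 2)) ^ 2 * (1 + t)) / ((1 - t) ^ 2 + (Real.tan (u / 2)) ^ 2 * (1 + t) ^ 2) ∧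
      Real.sin u / (1 - 2 * Real.cos u * t + t ^ 2) =
        2 * Real.tan (u / 2) / ((1 - t) ^ 2 + (Real.tan (u / 2)) ^ 2 * (1 + t) ^ 2)) := by
  sorry

/-! ## S5 — assembly: the parity tower sector -/

/-- **S5, assembly.** From the four descents (S3) and the partial fractions (S4): Conjecture 1 on the
REAL-ALGEBRAIC span of the symmetric Hurwitz tower. Decompose the coefficients along a `ℚ`-basis of
their span (`FormalRep ⧸ relations` is a `ℚ̄ ∩ ℝ`-module through `KZ.scale` / `IntegralRep.constMul`,
one slab + one scaling move realise `[σ, β f] ≡ β ⊙ [σ, f]`), reduce every rational component by the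
landed `stub_symReduction`, rewrite each symmetric pair by S4 and evaluate every Chebyshev kernel by S3:
both representations become `[box, C + A·∏ 2/(1+x_i²)]` with `C, A` real algebraic; equal values and
Lindemann over `ℚ̄` force `C = C′` and (`w = w′`) `A = A′` or (`w ≠ w′`) `A = A′ = 0` — then one
congruence move, resp. constants across dimensions (landed `stub_constAcrossDim`).
[cite: KontsevichZagier2001, §1.2 Conjecture 1] -/
theorem stub_assembly :
    -- the four descents (conclusion of S3), verbatim
    ((∀ (w j L : ℕ), 2 ≤ w → Even w → 0 < j → 2 * j < L → ∀ (r : KZ.IntegralRep w),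
      r.domain = {x | ∀ i, x i ∈ Set.Ioo (0:ℝ) 1} →
      Set.EqOn r.integrand (fun x =>
        ((1 - ∏ i, x i) - (Real.tan (Real.pi * j / L)) ^ 2 * (1 + ∏ i, x i)) /
          ((1 - ∏ i, x i) ^ 2 + (Real.tan (Real.pi * j / L)) ^ 2 * (1 + ∏ i, x i) ^ 2)) r.domain →
      ∃ q : ℚ, ∀ (s : KZ.IntegralRep w), s.domain = {x | ∀ i, x i ∈ Set.Ioo (0:ℝ) 1} →
        Set.EqOn s.integrand (fun x => (q : ℝ) * ∏ i, 2 / (1 + (x i) ^ 2)) s.domain →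
        KZ.Equivalent r s) ∧
    (∀ (w j L : ℕ), 3 ≤ w → Odd w → 0 < j → 2 * j < L → ∀ (r : KZ.IntegralRep w),
      r.domain = {x | ∀ i, x i ∈ Set.Ioo (0:ℝ) 1} →
      Set.EqOn r.integrand (fun x =>
        2 * Real.tan (Real.pi * j / L) /
          ((1 - ∏ i, x i) ^ 2 + (Real.tan (Real.pi * j / L)) ^ 2 * (1 + ∏ i, x i) ^ 2)) r.domain →
      ∃ q : ℚ, ∀ (s : KZ.IntegralRep w), s.domain = {x | ∀ i, x i ∈ Set.Ioo (0:ℝ) 1} →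
        Set.EqOn s.integrand (fun x => (q : ℝ) * ∏ i, 2 / (1 + (x i) ^ 2)) s.domain →
        KZ.Equivalent r s) ∧
    (∀ (w : ℕ), 2 ≤ w → Even w → ∀ (r : KZ.IntegralRep w),
      r.domain = {x | ∀ i, x i ∈ Set.Ioo (0:ℝ) 1} →
      Set.EqOn r.integrand (fun x => 1 / (1 - ∏ i, x i)) r.domain →
      ∃ q : ℚ, ∀ (s : KZ.IntegralRep w), s.domain = {x | ∀ i, x i ∈ Set.Ioo (0:ℝ) 1} →
        Set.EqOn s.integrand (fun x => (q : ℝ) * ∏ i, 2 / (1 + (x i) ^ 2)) s.domain →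
        KZ.Equivalent r s) ∧
    (∀ (w : ℕ), 2 ≤ w → Even w → ∀ (r : KZ.IntegralRep w),
      r.domain = {x | ∀ i, x i ∈ Set.Ioo (0:ℝ) 1} →
      Set.EqOn r.integrand (fun x => 1 / (1 + ∏ i, x i)) r.domain →
      ∃ q : ℚ, ∀ (s : KZ.IntegralRep w), s.domain = {x | ∀ i, x i ∈ Set.Ioo (0:ℝ) 1} →
        Set.EqOn s.integrand (fun x => (q : ℝ) * ∏ i, 2 / (1 + (x i) ^ 2)) s.domain →
        KZ.Equivalent r s)) →
    -- partial fractions (S4), verbatim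
    ((∀ (L a : ℕ), 0 < a → a < L → ∀ (t : ℝ), 0 ≤ t → t < 1 →
      (t ^ (a - 1) + t ^ (L - 1 - a)) / (1 - t ^ L) =
        2 / (L : ℝ) * ∑ j ∈ Finset.range L, Real.cos (2 * Real.pi * j * a / L) *
          ((Real.cos (2 * Real.pi * j / L) - t) / (1 - 2 * Real.cos (2 * Real.pi * j / L) * t + t ^ 2))) ∧
    (∀ (L a : ℕ), 0 < a → a < L → ∀ (t : ℝ), 0 ≤ t → t < 1 →
      (t ^ (a - 1) - t ^ (L - 1 - a)) / (1 - t ^ L) =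
        2 / (L : ℝ) * ∑ j ∈ Finset.range L, Real.sin (2 * Real.pi * j * a / L) *
          (Real.sin (2 * Real.pi * j / L) / (1 - 2 * Real.cos (2 * Real.pi * j / L) * t + t ^ 2))) ∧
    (∀ (u t : ℝ), 0 < u → u < Real.pi →
      (Real.cos u - t) / (1 - 2 * Real.cos u * t + t ^ 2) =
        ((1 - t) - (Real.tan (u / 2)) ^ 2 * (1 + t)) / ((1 - t) ^ 2 + (Real.tan (u / 2)) ^ 2 * (1 + t) ^ 2) ∧
      Real.sin u / (1 - 2 * Real.cos u * t + t ^ 2) =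
        2 * Real.tan (u / 2) / ((1 - t) ^ 2 + (Real.tan (u / 2)) ^ 2 * (1 + t) ^ 2))) →
    -- ParityTowerSector
    ∀ (w N w' N' : ℕ), 2 ≤ w → 1 ≤ N → 2 ≤ w' → 1 ≤ N' →
      ∀ (r : KZ.IntegralRep w) (r' : KZ.IntegralRep w'),
      (∃ (Q R : Polynomial ℝ), (∀ i, IsAlgebraic ℚ (Q.coeff i)) ∧ (∀ i, IsAlgebraic ℚ (R.coeff i)) ∧
        R.natDegree < N ∧ (∀ i j : ℕ, i + j + 2 = N → R.coeff i = (-1 : ℝ) ^ w * R.coeff j) ∧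
        (Odd w → R.coeff (N - 1) = 0) ∧ r.domain = {x | ∀ i, x i ∈ Set.Ioo (0:ℝ) 1} ∧
        Set.EqOn r.integrand (fun x => Polynomial.eval (∏ i, x i) Q +
          Polynomial.eval (∏ i, x i) R / (1 - (∏ i, x i) ^ N)) r.domain) →
      (∃ (Q R : Polynomial ℝ), (∀ i, IsAlgebraic ℚ (Q.coeff i)) ∧ (∀ i, IsAlgebraic ℚ (R.coeff i)) ∧
        R.natDegree < N' ∧ (∀ i j : ℕ, i + j + 2 = N' → R.coeff i = (-1 : ℝ) ^ w' * R.coeff j) ∧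
        (Odd w' → R.coeff (N' - 1) = 0) ∧ r'.domain = {x | ∀ i, x i ∈ Set.Ioo (0:ℝ) 1} ∧
        Set.EqOn r'.integrand (fun x => Polynomial.eval (∏ i, x i) Q +
          Polynomial.eval (∏ i, x i) R / (1 - (∏ i, x i) ^ N')) r'.domain) →
      r.value = r'.value → KZ.Equivalent r r' := by
  sorry

/-! ## S6 — the declared summit-strength remainder (NOT claimed) -/

/-- **S6, splice remainder — DECLARED SUMMIT-STRENGTH, not claimed.** Off the parity tower the values
involve the `ι`-odd `L`-values and odd zeta values, whose independence statements are open; modulo the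
parity tower sector this stub is `NormalFormPrinciple` ≡ the summit (Disproof.lean `crux_iff_summit`,
Negative/Core.lean `crux_iff_statement`). It exists so that `HurwitzSectorComplement_of` concludes the
crux by name; its outcome is `promote-stub`. [cite: KontsevichZagier2001, §1.2 Conjecture 1] -/
theorem stub_spliceRemainder :
    (∀ (w N w' N' : ℕ), 2 ≤ w → 1 ≤ N → 2 ≤ w' → 1 ≤ N' →
      ∀ (r : KZ.IntegralRep w) (r' : KZ.IntegralRep w'),
      (∃ (Q R : Polynomial ℝ), (∀ i, IsAlgebraic ℚ (Q.coeff i)) ∧ (∀ i, IsAlgebraic ℚ (R.coeff i)) ∧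
        R.natDegree < N ∧ (∀ i j : ℕ, i + j + 2 = N → R.coeff i = (-1 : ℝ) ^ w * R.coeff j) ∧
        (Odd w → R.coeff (N - 1) = 0) ∧ r.domain = {x | ∀ i, x i ∈ Set.Ioo (0:ℝ) 1} ∧
        Set.EqOn r.integrand (fun x => Polynomial.eval (∏ i, x i) Q +
          Polynomial.eval (∏ i, x i) R / (1 - (∏ i, x i) ^ N)) r.domain) →
      (∃ (Q R : Polynomial ℝ), (∀ i, IsAlgebraic ℚ (Q.coeff i)) ∧ (∀ i, IsAlgebraic ℚ (R.coeff i)) ∧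
        R.natDegree < N' ∧ (∀ i j : ℕ, i + j + 2 = N' → R.coeff i = (-1 : ℝ) ^ w' * R.coeff j) ∧
        (Odd w' → R.coeff (N' - 1) = 0) ∧ r'.domain = {x | ∀ i, x i ∈ Set.Ioo (0:ℝ) 1} ∧
        Set.EqOn r'.integrand (fun x => Polynomial.eval (∏ i, x i) Q +
          Polynomial.eval (∏ i, x i) R / (1 - (∏ i, x i) ^ N')) r'.domain) →
      r.value = r'.value → KZ.Equivalent r r') →
    NormalFormPrinciple := by
  sorry

/-! ## Composition -/

/-- **The parity tower sector** — Conjecture 1 of Kontsevich–Zagier on the real-algebraic span of the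
symmetric Hurwitz tower: any two representations `[(0,1)^w, Q(t) + R(t)/(1 − t^N)]`, `t = x₁⋯x_w`,
`Q, R ∈ (ℚ̄ ∩ ℝ)[t]`, `deg R < N`, `R` `(−1)^w`-symmetric, of any weights `w, w′ ≥ 2` and levels
`N, N′ ≥ 1`, with equal values are KZ-equivalent. Composition of S1–S5. [cite: KontsevichZagier2001, §1.2 Conjecture 1] -/
theorem parityTowerSector :
    ∀ (w N w' N' : ℕ), 2 ≤ w → 1 ≤ N → 2 ≤ w' → 1 ≤ N' →
      ∀ (r : KZ.IntegralRep w) (r' : KZ.IntegralRep w'),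
      (∃ (Q R : Polynomial ℝ), (∀ i, IsAlgebraic ℚ (Q.coeff i)) ∧ (∀ i, IsAlgebraic ℚ (R.coeff i)) ∧
        R.natDegree < N ∧ (∀ i j : ℕ, i + j + 2 = N → R.coeff i = (-1 : ℝ) ^ w * R.coeff j) ∧
        (Odd w → R.coeff (N - 1) = 0) ∧ r.domain = {x | ∀ i, x i ∈ Set.Ioo (0:ℝ) 1} ∧
        Set.EqOn r.integrand (fun x => Polynomial.eval (∏ i, x i) Q +
          Polynomial.eval (∏ i, x i) R / (1 - (∏ i, x i) ^ N)) r.domain) →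
      (∃ (Q R : Polynomial ℝ), (∀ i, IsAlgebraic ℚ (Q.coeff i)) ∧ (∀ i, IsAlgebraic ℚ (R.coeff i)) ∧
        R.natDegree < N' ∧ (∀ i j : ℕ, i + j + 2 = N' → R.coeff i = (-1 : ℝ) ^ w' * R.coeff j) ∧
        (Odd w' → R.coeff (N' - 1) = 0) ∧ r'.domain = {x | ∀ i, x i ∈ Set.Ioo (0:ℝ) 1} ∧
        Set.EqOn r'.integrand (fun x => Polynomial.eval (∏ i, x i) Q +
          Polynomial.eval (∏ i, x i) R / (1 - (∏ i, x i) ^ N')) r'.domain) →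
      r.value = r'.value → KZ.Equivalent r r' :=
  stub_assembly (stub_ladderDescent stub_ladderEngine stub_arcSimplex
    (stub_bottomCell stub_arcSimplex.1 stub_arcSimplex.2)) stub_partialFractions

/-- **The crux, by name, modulo the stubs**: the parity tower sector (S1–S5) spliced with the declared
summit-strength remainder S6. [cite: KontsevichZagier2001, §1.2 Conjecture 1] -/
theorem HurwitzSectorComplement_of : HurwitzSectorComplement :=
  fun _ _ => stub_spliceRemainder parityTowerSector

end Summit.KontsevichZagierPeriods.Theorems.HurwitzMicroSectorsHurwitzSectorComplement

end
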